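import Summits.BirchSwinnertonDyer.BirchSwinnertonDyer.Theorems.ResidualThetaTransportAtTwoResidualSignedLambdaLowerCMAtTwoStationRValVisibleLevels
import Summits.BirchSwinnertonDyer.BirchSwinnertonDyer.Theorems.ResidualThetaTransportAtTwoResidualSignedLambdaLowerCMAtTwoStationRRoadEval
import Literature.NumberTheory.EllipticCurves.PAdicPowerSeriesZeros
import Mathlib.RingTheory.PowerSeries.WeierstrassPreparation
import HarnessLib

/-!
# Station (R) step D′ kit: the displayed helper (H-FIN) PROVED — a nonzero `G ∈ Λ_𝒪 = 𝒪⟦T⟧` has FINITELY MANY zeros `z ∈ ℂ_p`, `|z| < 1`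
# (`ϖ`-content + `p`-adic Weierstrass preparation), hence no zero `ζ − 1` with `ζ` of exact order `p^N` for `N ≥ N₀(G)`; the quantitative
# VAL-visibility of a Kato valued class (`eventually_twistedSum_ne_zero_of_isPollackPairK`) becomes unconditional

Route `ResidualThetaTransportAtTwo` (RTT), crux RSL_g `ResidualSignedLambdaLowerCMAtTwo` (stmt-BirchSwinnertonDyer-22608), line «onepair» v3g,
registered KERNEL stub `stub_kzgValueRelation` = station (R) (writer `prover-bsd-wall-tp2-p2x-w3` g18; STUB-PLAN rev 29/30, S155/T90 step D′).
Width seat `prover-bsd-wall-tp2-p2x-w2` g22 (`--supports 22608 --as helper`, closes nothing). THEOREMS ONLY (no `def`, no instance, no notation,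
no named fact, no `sorry`). BSD is NOT proved by any of this; 22608 / 26074 / 24105 stay OPEN / HOLD.

WHAT. (H-FIN) is the ONE displayed helper of the ported k4-g26 §E (`StationRValVisible.hRIG_of_hFIN`,
`eventually_twistedSum_ne_zero_of_katoValuedClass / _of_isPollackPairK`, p724861): «`G ≠ 0 ⟹ ∃ N₀ ∀ N ≥ N₀ ∀ ζ` of exact order `p^N`,
`G(ζ − 1) ≠ 0`». It is the `𝒪`-version of the tree's `ℤ_p`-pattern `MemIwasawaRat.finite_setOf_hasSum_zero` (`PAdicPowerSeriesZeros.lean`):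
* §1 `ϖ`-CONTENT in `𝒪⟦T⟧` for a DVR `𝒪` (`exists_not_pow_dvd_of_irreducible`, `exists_eq_C_pow_mul_and_map_residue_ne_zero` — port of the
  `ℤ_p` lemmas of `IwasawaAlgebraStructureProofs.lean` with `p ↦ ϖ`);
* §2 `finite_setOf_tsum_eq_zero` — for `[ℚ_p(S) : ℚ_p] < ∞` and `G ∈ Λ_𝒪 ∖ 0` the zero set `{z ∈ ℂ_p : |z| < 1, G(z) = 0}` is finite: `G = ϖ^m · P · U`
  (`PowerSeries.weierstrassDistinguished / weierstrassUnit`, `𝒪` complete: `StationR.Road.isAdicComplete_padicCoeffIntegers`), evaluation is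
  multiplicative (`tsum_map_coeff_mul_mul_pow`), `U(z)·U⁻¹(z) = 1`, so `G(z) = 0 ⟹ P(z) = 0`, finitely many roots;
* §3 `hFIN_holds` — (H-FIN) in the exact displayed shape (a primitive `p^N`-th root `ζ` determines `N = log_p (orderOf ζ)`, so the levels carrying
  a zero inject into the finite zero set), and the UNCONDITIONAL corollaries `hRIG_holds` ((H-RIG) of §C, = `StationR.Road.eq_zero_of_forall_primitive_tsum_eq_zero`
  re-derived from (H-FIN)) and `eventually_twistedSum_ne_zero_of_isPollackPairK'` (k4-g26 §E with (H-FIN) discharged: the value vector of a Kato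
  valued class has `S_w(ψ) ≠ 0` at EVERY even primitive `ψ` of conductor `2^{N+2}`, `N ≥ N₀`).

References: [Washington1997] §7.1 Thm. 7.3, Prop. 7.2, Lemma 13.7; [Lang1990] Ch. 5 §2 Thm. 2.2; [MazurTateTeitelbaum1986Invent] §I.12.
-/

set_option autoImplicit false
-- the Theorems namespace of this sub repeats the summit name by design (D-0017 nested layout)
set_option linter.dupNamespace false

noncomputable section

open scoped Classical NumberField

open Polynomial
open Literature.NumberTheory.EllipticCurves Literature.NumberTheory.EllipticCurves.GreenbergSelmer
open Literature.NumberTheory.EllipticCurves.ModularForms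
open Literature.NumberTheory.GaloisRepresentations NumberField IsDedekindDomain Field
open GreenbergVatsal2000 Kobayashi2003 Rat.HeightOneSpectrum
open Summit.BirchSwinnertonDyer.Rank1Residual.Additive Summit.BirchSwinnertonDyer.Rank1Residual.Additive.PadicCyclotomicTower
open Summit.BirchSwinnertonDyer.BirchSwinnertonDyer.Theorems.OnePair
open Summit.BirchSwinnertonDyer.BirchSwinnertonDyer.Theorems
open Summit.BirchSwinnertonDyer.BirchSwinnertonDyer.Theorems.PollackPairK

namespace Summit.BirchSwinnertonDyer.BirchSwinnertonDyer.Theorems.ThetaTransport.StationRValVisible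

/-! ## §1 `ϖ`-content of a power series over a DVR -/

section Content

variable {𝒪 : Type*} [CommRing 𝒪] [IsDomain 𝒪] [IsDiscreteValuationRing 𝒪]

/-- In a DVR with uniformiser `ϖ`, a nonzero element is not divisible by arbitrarily high powers of `ϖ`. [cite: Washington1997, §13.1 Lemma 13.7] -/
theorem exists_not_pow_dvd_of_irreducible {ϖ : 𝒪} (hϖ : Irreducible ϖ) {x : 𝒪} (hx : x ≠ 0) : ∃ k : ℕ, ¬ ϖ ^ (k + 1) ∣ x := by
  obtain ⟨n, u, rfl⟩ := IsDiscreteValuationRing.eq_unit_mul_pow_irreducible hx hϖ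
  refine ⟨n, fun ⟨c, hc⟩ ↦ hϖ.not_isUnit ?_⟩
  have h0 : ϖ ^ n ≠ 0 := pow_ne_zero _ hϖ.ne_zero
  have : (u : 𝒪) = ϖ * c := by
    apply mul_right_cancel₀ h0
    rw [hc]; ring
  exact isUnit_of_mul_isUnit_left (this ▸ Units.isUnit u)

/-- **`ϖ`-content of a power series over a DVR**: a nonzero `a ∈ 𝒪⟦T⟧` is `ϖ^m · a'` with `a'` having nonzero reduction modulo `𝔪 = (ϖ)`
(the reduction performed before Weierstrass preparation). [cite: Washington1997, §7.1 (proof of Thm. 7.3), Lemma 13.7] -/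
theorem exists_eq_C_pow_mul_and_map_residue_ne_zero {ϖ : 𝒪} (hϖ : Irreducible ϖ) {a : PowerSeries 𝒪} (ha : a ≠ 0) :
    ∃ (m : ℕ) (a' : PowerSeries 𝒪), a = PowerSeries.C (ϖ ^ m) * a' ∧ a'.map (IsLocalRing.residue 𝒪) ≠ 0 := by
  classical
  have hex : ∃ m : ℕ, ∃ n, ¬ ϖ ^ (m + 1) ∣ PowerSeries.coeff n a := by
    obtain ⟨n, hn⟩ : ∃ n, PowerSeries.coeff n a ≠ 0 := by
      by_contra h
      push Not at h
      exact ha (PowerSeries.ext fun n ↦ by rw [h n, map_zero])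
    obtain ⟨k, hk⟩ := exists_not_pow_dvd_of_irreducible hϖ hn
    exact ⟨k, n, hk⟩
  let m := Nat.find hex
  have hdiv : ∀ n, ϖ ^ m ∣ PowerSeries.coeff n a := by
    intro n
    rcases Nat.eq_zero_or_eq_succ_pred m with h0 | hs
    · rw [h0, pow_zero]; exact one_dvd _
    · have := Nat.find_min hex (m := m - 1) (by omega)
      push Not at this
      rw [hs]; exact this n
  choose b hb using hdiv
  refine ⟨m, PowerSeries.mk b, ?_, ?_⟩
  · ext n
    rw [PowerSeries.coeff_C_mul, PowerSeries.coeff_mk, hb n]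
  · obtain ⟨n, hn⟩ := Nat.find_spec hex
    intro h
    apply hn
    have : IsLocalRing.residue 𝒪 (b n) = 0 := by
      have := congrArg (PowerSeries.coeff n) h
      rwa [PowerSeries.coeff_map, PowerSeries.coeff_mk, map_zero] at this
    rw [IsLocalRing.residue_eq_zero_iff, (IsDiscreteValuationRing.irreducible_iff_uniformizer ϖ).mp hϖ,
      Ideal.mem_span_singleton] at this
    obtain ⟨c, hc⟩ := this
    change ¬ ϖ ^ (m + 1) ∣ PowerSeries.coeff n a at hn
    rw [hb n, hc]
    exact ⟨c, by rw [pow_succ]; ring⟩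

end Content

/-! ## §2 A nonzero `G ∈ Λ_𝒪` has finitely many zeros in the open unit disc of `ℂ_p` -/

section Zeros

variable {p : ℕ} [hp : Fact p.Prime] (S : Set (PadicAlgCl p))

/-- **Finiteness of the zeros of `G ∈ Λ_𝒪 ∖ 0` in `{|z| < 1} ⊂ ℂ_p`** (`[ℚ_p(S) : ℚ_p] < ∞`): write `G = ϖ^m · P · U` with `P` distinguished and
`U ∈ Λ_𝒪ˣ` (`ϖ`-content, then `p`-adic Weierstrass preparation in the complete DVR `𝒪`); evaluation at `|z| < 1` is multiplicative and `U(z)` is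
invertible, so `G(z) = 0` forces `P(z) = 0`: finitely many roots. The `𝒪`-version of `MemIwasawaRat.finite_setOf_hasSum_zero`.
[cite: Washington1997, §7.1 Thm. 7.3] [cite: Lang1990, Ch. 5 §2 Thm. 2.2] -/
theorem finite_setOf_tsum_eq_zero [FiniteDimensional ℚ_[p] (padicCoeffField S)] (G : IwasawaAlgebraO S) (hG0 : G ≠ 0) :
    {z : ℂ_[p] | ‖z‖ < 1 ∧
      ∑' k, ((algebraMap (PadicAlgCl p) ℂ_[p]).comp (padicCoeffIntegers S).subtype) (PowerSeries.coeff k G) * z ^ k = 0}.Finite := by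
  classical
  haveI : IsDiscreteValuationRing (padicCoeffIntegers S) := isDiscreteValuationRing_padicCoeffIntegers
  haveI : IsAdicComplete (IsLocalRing.maximalIdeal (padicCoeffIntegers S)) (padicCoeffIntegers S) :=
    StationR.Road.isAdicComplete_padicCoeffIntegers S
  set φ : padicCoeffIntegers S →+* ℂ_[p] := (algebraMap (PadicAlgCl p) ℂ_[p]).comp (padicCoeffIntegers S).subtype with hφ
  have hbd : ∀ (A : IwasawaAlgebraO S) (k : ℕ), ‖φ (PowerSeries.coeff k A)‖ ≤ 1 := fun A k ↦ by
    rw [hφ, RingHom.comp_apply, Subring.subtype_apply]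
    exact (PadicComplex.norm_extends (p := p) _).trans_le (PowerSeries.coeff k A).2.2
  have hφinj : Function.Injective φ := (algebraMap (PadicAlgCl p) ℂ_[p]).injective.comp Subtype.val_injective
  -- `ϖ`-content and Weierstrass preparation: `G = ϖ^m P U`
  obtain ⟨ϖ, hϖ⟩ := IsDiscreteValuationRing.exists_irreducible (padicCoeffIntegers S)
  obtain ⟨m, G', hGG', hG'⟩ := exists_eq_C_pow_mul_and_map_residue_ne_zero hϖ hG0
  set P : Polynomial (padicCoeffIntegers S) := G'.weierstrassDistinguished hG' with hP
  set U : IwasawaAlgebraO S := G'.weierstrassUnit hG' with hU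
  have hfac : G' = (P : IwasawaAlgebraO S) * U := G'.eq_weierstrassDistinguished_mul_weierstrassUnit hG'
  have hPmonic : P.Monic := (G'.isDistinguishedAt_weierstrassDistinguished hG').monic
  obtain ⟨V, hUV⟩ := (G'.isUnit_weierstrassUnit hG').exists_right_inv
  have hPne : P.map φ ≠ 0 := (hPmonic.map φ).ne_zero
  -- the zeros are roots of `P`
  refine (P.map φ).roots.toFinset.finite_toSet.subset ?_
  rintro z ⟨hz, hsum⟩
  simp only [Finset.mem_coe, Multiset.mem_toFinset]
  rw [Polynomial.mem_roots hPne, Polynomial.IsRoot.def, Polynomial.eval_map]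
  -- `G(z) = ϖ^m P(z) U(z)` and `U(z) V(z) = 1`
  have hGeval : ∑' k, φ (PowerSeries.coeff k G) * z ^ k =
      φ (ϖ ^ m) * (P.eval₂ φ z * ∑' k, φ (PowerSeries.coeff k U) * z ^ k) := by
    rw [hGG', tsum_map_coeff_mul_mul_pow φ (hbd _) (hbd _) hz, (hasSum_map_coeff_C_mul_pow φ _ z).tsum_eq, hfac,
      tsum_map_coeff_mul_mul_pow φ (hbd _) (hbd _) hz, (hasSum_map_coeff_coe_mul_pow φ P z).tsum_eq]
  have hUV' : (∑' k, φ (PowerSeries.coeff k U) * z ^ k) * ∑' k, φ (PowerSeries.coeff k V) * z ^ k = 1 := by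
    rw [← tsum_map_coeff_mul_mul_pow φ (hbd _) (hbd _) hz, hUV, (hasSum_map_coeff_one_mul_pow φ z).tsum_eq]
  have hUne : ∑' k, φ (PowerSeries.coeff k U) * z ^ k ≠ 0 := left_ne_zero_of_mul_eq_one hUV'
  have hpm : φ (ϖ ^ m) ≠ 0 := by
    rw [map_ne_zero_iff φ hφinj]
    exact pow_ne_zero _ hϖ.ne_zero
  rw [hsum] at hGeval
  have h := (mul_eq_zero.mp hGeval.symm).resolve_left hpm
  exact (mul_eq_zero.mp h).resolve_right hUne

/-- **(H-FIN) PROVED.** For `G ∈ Λ_𝒪 ∖ 0` there is `N₀` such that `G(ζ − 1) ≠ 0` for every `ζ ∈ ℂ_p` of exact order `p^N`, `N ≥ N₀`: a primitive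
`p^N`-th root `ζ` determines its level (`N = log_p (orderOf ζ)`), so the set of levels carrying a zero `ζ − 1` is the image of the finite zero set
of §2 and is bounded. Exactly the displayed hypothesis `hFIN` of `hRIG_of_hFIN` / `eventually_twistedSum_ne_zero_of_katoValuedClass`
(specialised to `p = 2` there). [cite: Washington1997, §7.1 Thm. 7.3] -/
theorem hFIN_holds [FiniteDimensional ℚ_[p] (padicCoeffField S)] (G : IwasawaAlgebraO S) (hG0 : G ≠ 0) :
    ∃ N₀ : ℕ, ∀ N : ℕ, N₀ ≤ N → ∀ ζ : ℂ_[p], IsPrimitiveRoot ζ (p ^ N) →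
      ∑' k, ((algebraMap (PadicAlgCl p) ℂ_[p]).comp (padicCoeffIntegers S).subtype) (PowerSeries.coeff k G) * (ζ - 1) ^ k ≠ 0 := by
  classical
  have hfin := finite_setOf_tsum_eq_zero S G hG0
  -- the levels carrying a zero are the image of the zero set under `z ↦ log_p (orderOf (z + 1))`
  set bad : Set ℕ := {N | ∃ ζ : ℂ_[p], IsPrimitiveRoot ζ (p ^ N) ∧
      ∑' k, ((algebraMap (PadicAlgCl p) ℂ_[p]).comp (padicCoeffIntegers S).subtype) (PowerSeries.coeff k G) * (ζ - 1) ^ k = 0} with hbad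
  have hsub : bad ⊆ (fun z : ℂ_[p] ↦ Nat.log p (orderOf (z + 1))) ''
      {z : ℂ_[p] | ‖z‖ < 1 ∧
        ∑' k, ((algebraMap (PadicAlgCl p) ℂ_[p]).comp (padicCoeffIntegers S).subtype) (PowerSeries.coeff k G) * z ^ k = 0} := by
    rintro N ⟨ζ, hζ, h0⟩
    refine ⟨ζ - 1, ⟨norm_sub_one_lt_one_of_pow_prime_pow_eq_one hζ.pow_eq_one, h0⟩, ?_⟩
    show Nat.log p (orderOf (ζ - 1 + 1)) = N
    rw [sub_add_cancel, ← hζ.eq_orderOf, Nat.log_pow hp.out.one_lt]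
  have hbadfin : bad.Finite := (hfin.image _).subset hsub
  obtain ⟨M, hM⟩ := hbadfin.bddAbove
  refine ⟨M + 1, fun N hN ζ hζ h0 ↦ ?_⟩
  have hNbad : N ∈ bad := ⟨ζ, hζ, h0⟩
  have := hM hNbad
  omega

/-- **(H-RIG) from (H-FIN), unconditionally**: an element of `Λ_𝒪` vanishing at `ζ − 1` for all primitive `ζ` of order `2^{ℓ_i+1}` along an
unbounded family of levels `ℓ_i` is `0` (the displayed `hRIG` of `not_katoValuedClass_of_valInvisible`; also = `StationR.Road.eq_zero_of_forall_primitive_tsum_eq_zero`).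
[cite: Washington1997, §7.1 Thm. 7.3, Prop. 7.2] -/
theorem hRIG_holds {S : Set (PadicAlgCl 2)} [FiniteDimensional ℚ_[2] (padicCoeffField S)] :
    ∀ (G : IwasawaAlgebraO S) (ℓ : ℕ → ℕ), (∀ m : ℕ, ∃ i, m < ℓ i) →
      (∀ (i : ℕ) (ζ : ℂ_[2]), IsPrimitiveRoot ζ (2 ^ (ℓ i + 1)) →
        ∑' k, ((algebraMap (PadicAlgCl 2) ℂ_[2]).comp (padicCoeffIntegers S).subtype) (PowerSeries.coeff k G) * (ζ - 1) ^ k = 0) →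
      G = 0 :=
  hRIG_of_hFIN (fun G hG ↦ hFIN_holds S G hG)

end Zeros

/-! ## §3 Quantitative VAL-visibility of a Kato valued class, (H-FIN) discharged -/

section Levels

variable {M : ℕ} [NeZero M] (g : CuspForm (CongruenceSubgroup.Gamma0 M) 2) (ι : coeffField g →+* PadicAlgCl 2) (Ω : ℂ)
  {W : WeierstrassCurve ℚ} [W.IsElliptic] {κ : ZpExtension ℚ 2} {γ : absoluteGaloisGroup ℚ}
  {S₀ : Finset (HeightOneSpectrum (𝓞 ℚ))} {n : ℕ}

/-- **Quantitative wildness, unconditional** (k4-g26 §E with (H-FIN) := `hFIN_holds`): on `S = range ι`, with the Pollack-pair binder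
`IsPollackPairK g ι Ω Lp Lm` of RSL_g, the value vector `w` of ANY Kato valued class `(z, c′, w, q, μt)` of child A has a NON-VANISHING twisted Galois
sum `S_w(ψ) = Σ_j bO_j Σ_b ψ⁻¹(b) τ_b • w_{N+2,j}` at EVERY even primitive `ψ` of conductor `2^{N+2}`, for all `N ≥ N₀(μt, L⁺, L⁻)` — the value-side
non-vanishing consumed by the (R) writer's step D′ / `ν ≠ 0`. [cite: Kato2004Asterisque, Thm. 12.5 (1) (pp. 221–222), §15.16 (p. 265)] [cite: Pollack2003, Cor. 5.11, Prop. 6.18] -/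
theorem eventually_twistedSum_ne_zero_of_isPollackPairK' [W.IsGloballyMinimal]
    {ρ₁ : FramedGaloisRep ℚ ↥(padicCoeffIntegers (Set.range ι)) 2}
    {Θ₁ : ∀ v : HeightOneSpectrum (𝓞 ℚ), ((2 : ℕ) : 𝓞 ℚ) ∈ v.asIdeal →
      (Cofree ρ₁ ↥(padicCoeffField (Set.range ι)) ≃+ (Fin n → ↥(W.geomPrimaryTorsion 2)))}
    {hΘ₁ : ∀ v hv (δ : absoluteGaloisGroup (v.adicCompletion ℚ)) m i,
      Θ₁ v hv (resGalOfEmb (closureEmb (K := ℚ) (v.adicCompletion ℚ)) δ • m) i =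
        resGalOfEmb (closureEmb (K := ℚ) (v.adicCompletion ℚ)) δ • Θ₁ v hv m i}
    {I₁ : Kato2004.IwasawaH1DataCoeff (FramedGaloisRep.toGaloisRep ρ₁) 2 κ γ}
    {Sg₁ : AddSubgroup (subgroupH1 κ.kerSubgroup (Cofree ρ₁ ↥(padicCoeffField (Set.range ι))))}
    [Module ↥(padicCoeffIntegers (Set.range ι)) ↥Sg₁] [FiniteDimensional ℚ_[2] (padicCoeffField (Set.range ι))]
    (π₁ : OnePairPins (Set.range ι) W κ γ S₀ n ρ₁ Θ₁ hΘ₁ I₁ Sg₁)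
    {Lp Lm : IwasawaAlgebraO (Set.range ι)} (hL : IsPollackPairK g ι Ω Lp Lm)
    {Φ : AlgebraicClosure ℚ_[2] ≃ₐ[ℚ] AlgebraicClosure (π₁.v.adicCompletion ℚ)}
    {τ : ∀ m : ℕ, ZMod (2 ^ m) → Field.absoluteGaloisGroup ℚ_[2]} {z : I₁.H} {c' : Fin n → ↥(padicCoeffIntegers (Set.range ι))}
    {w : ℕ → Fin π₁.nb → PadicAlgCl 2} {q : PadicAlgCl 2} {μt : IwasawaAlgebraO (Set.range ι)}
    (hcl : π₁.KatoValuedClass g ι Ω Φ τ z c' w q μt) :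
    ∃ N₀ : ℕ, ∀ N : ℕ, N₀ ≤ N → ∀ ψ : DirichletCharacter (PadicAlgCl 2) (2 ^ (N + 2)), ψ (-1) = 1 → ψ.IsPrimitive →
      ∑ j : Fin π₁.nb, ((π₁.bO j : ↥(padicCoeffIntegers (Set.range ι))) : PadicAlgCl 2) *
          ∑ b : (ZMod (2 ^ (N + 2)))ˣ, ψ⁻¹ (b : ZMod (2 ^ (N + 2))) * τ (N + 2) (b : ZMod (2 ^ (N + 2))) • w (N + 2) j ≠ 0 :=
  eventually_twistedSum_ne_zero_of_isPollackPairK g ι Ω π₁ hL (fun G hG ↦ hFIN_holds (Set.range ι) G hG) hcl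

end Levels

end Summit.BirchSwinnertonDyer.BirchSwinnertonDyer.Theorems.ThetaTransport.StationRValVisible

end
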